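import Mathlib

/-!
# SoloBlind E79 — the weight constant `8` of PROPOSITION A (session s125)

For a prime `ℓ = 2m+1` the Stickelberger exponent of the Jacobi sum `J(χ̄,χ̄)` at `σ_c⁻¹𝔔` is the carry
indicator of `c + c`, i.e. `1` exactly for `ℓ/2 < c < ℓ`.  Hence the `ω⁻¹`-projection `Π_c σ_c(J)^c`
has divisor `(Σ_{ℓ/2<d<ℓ} d) · Σ_e e·σ_e𝔔 (mod ℓ)`, and the identities below show
`8 · Σ_{ℓ/2<d<ℓ} d ≡ 1 (mod ℓ)`.  This is the constant `8` in `Γᵢ = 8·Sᵢ` (PROPOSITION A) and the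
constant `64 = 8²` of the unit-free reciprocity identity (ix′)
`12T + K₁₂K₂₁ + 144m₁m₂ ≡ 64·S₁S₂ (mod ℓ)`, verified on 236 pairs of primes at twelve primes `ℓ ≤ 43`
(84 of them pre-registered with this constant).  Pure arithmetic; no axioms beyond Mathlib's.
-/

namespace Summit.Langlands.Langlands.Theorems

open Finset

/-- Twice the sum of the upper half `{m+1,…,2m}` of the nonzero residues modulo `2m+1`
is `m(3m+1)`.  (The sum is written as `Σ_{i<m} (m+1+i)`.) -/
theorem soloBlind_upperHalf_sum_two_mul (m : ℕ) :
    2 * ∑ i ∈ range m, (m + 1 + i) = m * (3 * m + 1) := by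
  have h1 : ∑ i ∈ range m, (m + 1 + i) = m * (m + 1) + ∑ i ∈ range m, i := by
    rw [Finset.sum_add_distrib, Finset.sum_const, Finset.card_range, smul_eq_mul]
  have h2 := Finset.sum_range_id_mul_two m
  rcases Nat.eq_zero_or_pos m with rfl | hm
  · simp
  · obtain ⟨k, rfl⟩ := Nat.exists_eq_add_of_le hm
    have hk : 1 + k - 1 = k := by omega
    rw [hk] at h2
    rw [h1]
    nlinarith [h2]

/-- `8 · Σ_{ℓ/2<d<ℓ} d = (2m+1)(6m-1) + 1` for `ℓ = 2m+1 ≥ 3`: the Stickelberger weight of the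
`ω⁻¹`-projected Jacobi sum is `1/8` modulo `ℓ`. -/
theorem soloBlind_stickelbergerWeight (m : ℕ) (hm : 1 ≤ m) :
    8 * ∑ i ∈ range m, (m + 1 + i) = (2 * m + 1) * (6 * m - 1) + 1 := by
  have h := soloBlind_upperHalf_sum_two_mul m
  obtain ⟨k, rfl⟩ := Nat.exists_eq_add_of_le hm
  have e : 6 * (1 + k) - 1 = 6 * k + 5 := by omega
  rw [e]
  nlinarith [h]

/-- The same statement in `ZMod ℓ`, `ℓ = 2m+1`: `8 · Σ_{ℓ/2<d<ℓ} d = 1`. -/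
theorem soloBlind_stickelbergerWeight_zmod (m : ℕ) (hm : 1 ≤ m) :
    ((8 * ∑ i ∈ range m, (m + 1 + i) : ℕ) : ZMod (2 * m + 1)) = 1 := by
  rw [soloBlind_stickelbergerWeight m hm]
  have hz : ((2 * m + 1 : ℕ) : ZMod (2 * m + 1)) = 0 := ZMod.natCast_self (2 * m + 1)
  have hsplit : (((2 * m + 1) * (6 * m - 1) + 1 : ℕ) : ZMod (2 * m + 1))
      = ((2 * m + 1 : ℕ) : ZMod (2 * m + 1)) * ((6 * m - 1 : ℕ) : ZMod (2 * m + 1)) + 1 := by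
    push_cast
    ring
  rw [hsplit, hz, zero_mul, zero_add]

end Summit.Langlands.Langlands.Theorems
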